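import Summits.CriticalPhenomena.PercolationContinuityZ3.Theorems.PercNearOneGluingNoHeavyLowerTailSahiOrCylindersPrelim

/-!
# `NoHeavyLowerTail` (crux stmt-CriticalPhenomena-4575), Sahi / Kahn positivity: the OR OF TWO DISJOINT CYLINDERS slot (I) — the certificate

Support file (cell `prim-l12`, seat P3, gen 8; `--supports stmt-CriticalPhenomena-4575`).  No `sorry`, no named facts, standard axioms.
New mathematics (this programme).

**THEOREM (Kahn's Conjecture 5 / Sahi's `C₃` when the first slot is the OR of two disjoint cylinders).**  Let a finite block of
coordinates of a finite product space be split as `S ⊔ Sᶜ`, with parameters in `(0,1)` on the block, and let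
`H = {ω : S ⊆ ω} ∪ {ω : Sᶜ ⊆ ω}` ("all of `S` open, or all of `Sᶜ` open"; the read-once function `(∧_S x) ∨ (∧_{Sᶜ} x)`).
Then `E₃(1_H, 1_U, 1_V) ≥ 0` for ALL increasing `U, V`, in every dimension (`sahiE_three_nonneg_of_orCyl`, pattern form; the event
forms are in the companion file `…SahiOrCylindersEvent`; the sections, product formulas and real inequalities in `…SahiOrCylindersPrelim`).  For `min(|S|,|Sᶜ|) ≥ 2` and `|S| + |Sᶜ| ≥ 5` (e.g. `ab ∨ cde`) these slots
are new: `|S| = 1` is a cascade (`…SahiTransportCascade`), blocks of `≤ 4` coordinates are `…SahiTransportJRFour`.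

PROOF.  `ρ = μ(· | exactly one of the two cylinders occurs)` is a reduced transport certificate (`rhoCert_orCyl`,
`…SahiTransportRho.RhoCert`):
* TRACE REDUCTION (`…SahiTransportTrace.rhoCert_of_hat`): the trace-maximal family of an up-set `𝒳` is the PRODUCT
  `hat H 𝒳 = 𝒳^{S} ∩ 𝒳^{Sᶜ}` of its two sections `𝒳^{S} = {ω : ω ∪ S ∈ 𝒳}` (determined by `Sᶜ`) and `𝒳^{Sᶜ}` (determined by `S`)
  (`hat_orCyl`), so by independence every probability in the rows (o), (TC) is a polynomial in `P = μ(S open)`, `Q = μ(Sᶜ open)` and the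
  section probabilities `x_S = μ(𝒳^{Sᶜ}) ∈ [P,1]`, `x_T = μ(𝒳^{S}) ∈ [Q,1]`, `y_S = μ(𝒳^{Sᶜ} ∩ 𝒵^{Sᶜ})`, … (`pr_orCyl_inter_hat`, …);
* (TC) becomes `θδ·(P y_T + Q y_S − 2PQ) ≤ π·[(2−θ)(P y_T + Q y_S − PQ) + θ·x_Sx_T·z_Sz_T − x_Sx_T(P z_T + Q z_S − PQ) − z_Sz_T(P x_T + Q x_S − PQ)]`
  (`θ = P+Q−PQ`, `δ = (1−P)(1−Q)`, `π = P+Q−2PQ`).  The difference is AFFINE AND INCREASING in `y_S, y_T` (coefficients `Q(π−PQδ)`,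
  `P(π−PQδ) ≥ 0`), so by Harris (`y ≥ xz` per block) one may substitute `y = xz`; the result is MULTI-AFFINE in
  `(x_S, z_S, x_T, z_T) ∈ [P,1]² × [Q,1]²`, and its sixteen vertex values are the explicit nonnegative products of `or_vertex_nonneg`
  (three of them vanish) — `or_tc_real`, one `ring` identity;
* (o) is `π ab ≤ δ(Pb + Qa)` for `a ∈ [0,1−P]`, `b ∈ [0,1−Q]` (`or_o_real`); (a) is `(2−θ)π − θδ = π − PQδ ≥ 0`.
Numerically (seat gen 8) the same law `μ(· | exactly t blocks full)` certifies every threshold-of-disjoint-cylinders event through `k = 7`;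
this file settles `t = 1`, two blocks. [this work]
-/

noncomputable section

open scoped Classical

namespace Summit.CriticalPhenomena.PercolationContinuityZ3.Theorems

namespace SahiOrCylinders

open Finset
open SahiHittingSlot SahiTransportCert SahiCombPrincipalMeet
open Literature.Combinatorics.Sahi2008
open Literature.Probability.Percolation (DeterminedBy determinedBy_iff)
open Literature.Probability.Percolation.BHK2006 (ind_inter)
open Literature.Probability.Percolation.DecisionTree (ind ind_of_mem ind_of_not_mem ind_nonneg)

variable {k : ℕ}

variable (q : Fin k → unitInterval) (S : Set (Fin k))

section Cert

variable {q} (hq : ∀ i, 0 < (q i : ℝ) ∧ (q i : ℝ) < 1)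
include hq

/-- `0 < μ(⊤) < 1` for a nonempty block with interior parameters. [this work] -/
theorem pr_top_pos_lt (hk : 0 < k) : 0 < pr q ({Set.univ} : Set (Set (Fin k))) ∧ pr q ({Set.univ} : Set (Set (Fin k))) < 1 := by
  rw [pr_top_eq_prod]
  refine ⟨prod_pos fun i _ => (hq i).1, ?_⟩
  rw [← mul_prod_erase univ (fun i => (q i : ℝ)) (mem_univ ⟨0, hk⟩)]
  have h1 : ∏ i ∈ univ.erase (⟨0, hk⟩ : Fin k), (q i : ℝ) ≤ 1 := prod_le_one (fun i _ => (hq i).1.le) fun i _ => (hq i).2.le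
  have h0 : 0 ≤ ∏ i ∈ univ.erase (⟨0, hk⟩ : Fin k), (q i : ℝ) := prod_nonneg fun i _ => (hq i).1.le
  nlinarith [(hq ⟨0, hk⟩).2, (hq ⟨0, hk⟩).1]

/-- The basic inequalities between `P = μ(S open)` and `Q = μ(Sᶜ open)`: both in `(0,1]`, and `π = P + Q − 2PQ > 0`. [this work] -/
theorem pi_pos (hk : 0 < k) :
    0 < pr q {U : Set (Fin k) | S ⊆ U} + pr q {U : Set (Fin k) | Sᶜ ⊆ U} - 2 * (pr q {U : Set (Fin k) | S ⊆ U} * pr q {U : Set (Fin k) | Sᶜ ⊆ U}) := by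
  obtain ⟨htop0, htop1⟩ := pr_top_pos_lt (q := q) hq hk
  rw [pr_top q S] at htop0 htop1
  have hP0 : 0 ≤ pr q {U : Set (Fin k) | S ⊆ U} := pr_nonneg q _
  have hP1 : pr q {U : Set (Fin k) | S ⊆ U} ≤ 1 := pr_le_one q _
  have hQ0 : 0 ≤ pr q {U : Set (Fin k) | Sᶜ ⊆ U} := pr_nonneg q _
  have hQ1 : pr q {U : Set (Fin k) | Sᶜ ⊆ U} ≤ 1 := pr_le_one q _
  have hQpos : 0 < pr q {U : Set (Fin k) | Sᶜ ⊆ U} := by nlinarith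
  rcases lt_or_eq_of_le hP1 with hP | hP
  · nlinarith [mul_pos hQpos (sub_pos.2 hP), mul_nonneg hP0 (sub_nonneg.2 hQ1)]
  · rw [hP, one_mul] at htop1
    rw [hP]; linarith

set_option maxHeartbeats 1600000 in
/-- **THE CERTIFICATE FOR THE OR OF TWO DISJOINT CYLINDERS.**  For interior parameters (nonempty block),
`ρ = μ(· | exactly one of the two cylinders)` is a reduced transport certificate of `orCyl S`. [this work] -/
theorem rhoCert_orCyl (hk : 0 < k) : RhoCert q (orCyl S) (rho q S) := by
  -- the two block probabilities and the basic inequalities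
  have hP0 : 0 ≤ pr q {U : Set (Fin k) | S ⊆ U} := pr_nonneg q _
  have hP1 : pr q {U : Set (Fin k) | S ⊆ U} ≤ 1 := pr_le_one q _
  have hQ0 : 0 ≤ pr q {U : Set (Fin k) | Sᶜ ⊆ U} := pr_nonneg q _
  have hQ1 : pr q {U : Set (Fin k) | Sᶜ ⊆ U} ≤ 1 := pr_le_one q _
  have hπpos := pi_pos S hq hk
  have hc := pi_sub_nonneg _ _ hP0 hP1 hQ0 hQ1
  have hθ1 : pr q (orCyl S) ≤ 1 := pr_le_one q _
  refine rhoCert_of_hat (isUpperSet_orCyl S) (fun T => ?_) (fun T hT => ?_) ?_ (fun T => ?_) (fun 𝒯 h𝒯 => ?_) (fun 𝒳 𝒵 h𝒳 h𝒵 => ?_)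
  · -- `ρ ≥ 0`
    exact div_nonneg (mul_nonneg (bw_nonneg q T) (ind_nonneg _ T)) (pr_nonneg q _)
  · -- `ρ = 0` off the event
    rw [rho, ind_of_not_mem (fun h : T ∈ exone S => hT h.2), mul_zero, zero_div]
  · -- total mass `1`
    have h := sum_rho_ind q S Set.univ
    simp only [ind_of_mem (Set.mem_univ _), mul_one, Set.inter_univ] at h
    rw [h, pr_exone]; exact div_self hπpos.ne'
  · -- (a) capacity
    by_cases hT : T ∈ exone S
    · rw [rho, ind_of_mem hT, mul_one, pr_orCyl, pr_exone]
      have hcap : (pr q {U : Set (Fin k) | S ⊆ U} + pr q {U : Set (Fin k) | Sᶜ ⊆ U} - pr q {U : Set (Fin k) | S ⊆ U} * pr q {U : Set (Fin k) | Sᶜ ⊆ U})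
          * (1 - (pr q {U : Set (Fin k) | S ⊆ U} + pr q {U : Set (Fin k) | Sᶜ ⊆ U} - pr q {U : Set (Fin k) | S ⊆ U} * pr q {U : Set (Fin k) | Sᶜ ⊆ U}))
          / (pr q {U : Set (Fin k) | S ⊆ U} + pr q {U : Set (Fin k) | Sᶜ ⊆ U} - 2 * (pr q {U : Set (Fin k) | S ⊆ U} * pr q {U : Set (Fin k) | Sᶜ ⊆ U}))
          ≤ 2 - (pr q {U : Set (Fin k) | S ⊆ U} + pr q {U : Set (Fin k) | Sᶜ ⊆ U} - pr q {U : Set (Fin k) | S ⊆ U} * pr q {U : Set (Fin k) | Sᶜ ⊆ U}) := by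
        rw [div_le_iff₀ hπpos]; nlinarith [hc]
      rw [← mul_div_assoc, mul_div_right_comm]
      exact mul_le_mul_of_nonneg_right hcap (bw_nonneg q T)
    · rw [rho, ind_of_not_mem hT, mul_zero, zero_div, mul_zero]
      exact mul_nonneg (by linarith) (bw_nonneg q T)
  · -- (o) domination, on trace-maximal families
    by_cases hne : 𝒯.Nonempty
    · have huniv : Set.univ ∈ 𝒯 := by obtain ⟨ω, hω⟩ := hne; exact h𝒯 (Set.subset_univ ω) hω
      rw [sum_rho_ind, pr_compl_inter_hat q S h𝒯 huniv, pr_exone_inter_hat q S h𝒯 huniv, pr_orCyl, pr_exone, ← mul_div_assoc,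
        le_div_iff₀ hπpos]
      have htS : pr q {U : Set (Fin k) | S ⊆ U} ≤ pr q (secUnion Sᶜ 𝒯) := pr_mono q (cyl_subset_secUnion_compl S huniv)
      have htT : pr q {U : Set (Fin k) | Sᶜ ⊆ U} ≤ pr q (secUnion S 𝒯) := pr_mono q (cyl_compl_subset_secUnion S huniv)
      have key := or_o_real _ _ (pr q (secUnion Sᶜ 𝒯)) (pr q (secUnion S 𝒯)) hP0 hQ0 htS (pr_le_one q _) htT (pr_le_one q _)
      linarith [key]
    · rw [Set.not_nonempty_iff_eq_empty.1 hne, hat_empty, Set.inter_empty, SahiTransportCert.pr_empty]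
      exact mul_nonneg (by linarith) (sum_nonneg fun T _ => by
        rw [ind_of_not_mem (Set.notMem_empty T), mul_zero])
  · -- (TC) on pairs of trace-maximal families
    by_cases hne : 𝒳.Nonempty ∧ 𝒵.Nonempty
    · obtain ⟨hX, hZ⟩ := hne
      have hXu : Set.univ ∈ 𝒳 := h𝒳 (Set.subset_univ _) hX.some_mem
      have hZu : Set.univ ∈ 𝒵 := h𝒵 (Set.subset_univ _) hZ.some_mem
      have hXZu : Set.univ ∈ 𝒳 ∩ 𝒵 := ⟨hXu, hZu⟩
      have h𝒳𝒵 : IsUpperSet (𝒳 ∩ 𝒵) := h𝒳.inter h𝒵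
      rw [sum_rho_ind, tcRHS_eq, ← hat_inter, pr_exone_inter_hat q S h𝒳𝒵 hXZu, pr_orCyl_inter_hat q S h𝒳𝒵 hXZu,
        pr_hat q S h𝒳, pr_hat q S h𝒵, pr_orCyl_inter_hat q S h𝒳 hXu, pr_orCyl_inter_hat q S h𝒵 hZu, pr_orCyl, pr_exone,
        ← mul_div_assoc, div_le_iff₀ hπpos]
      -- the section probabilities
      have hxS : pr q {U : Set (Fin k) | S ⊆ U} ≤ pr q (secUnion Sᶜ 𝒳) := pr_mono q (cyl_subset_secUnion_compl S hXu)
      have hzS : pr q {U : Set (Fin k) | S ⊆ U} ≤ pr q (secUnion Sᶜ 𝒵) := pr_mono q (cyl_subset_secUnion_compl S hZu)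
      have hxT : pr q {U : Set (Fin k) | Sᶜ ⊆ U} ≤ pr q (secUnion S 𝒳) := pr_mono q (cyl_compl_subset_secUnion S hXu)
      have hzT : pr q {U : Set (Fin k) | Sᶜ ⊆ U} ≤ pr q (secUnion S 𝒵) := pr_mono q (cyl_compl_subset_secUnion S hZu)
      -- Harris inside each block
      have hyS : pr q (secUnion Sᶜ 𝒳) * pr q (secUnion Sᶜ 𝒵) ≤ pr q (secUnion Sᶜ (𝒳 ∩ 𝒵)) :=
        pr_mul_pr_le_pr_inter q (isUpperSet_secUnion Sᶜ h𝒳) (isUpperSet_secUnion Sᶜ h𝒵)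
      have hyT : pr q (secUnion S 𝒳) * pr q (secUnion S 𝒵) ≤ pr q (secUnion S (𝒳 ∩ 𝒵)) :=
        pr_mul_pr_le_pr_inter q (isUpperSet_secUnion S h𝒳) (isUpperSet_secUnion S h𝒵)
      have key := or_tc_real _ _ (pr q (secUnion Sᶜ 𝒳)) (pr q (secUnion Sᶜ 𝒵)) (pr q (secUnion Sᶜ (𝒳 ∩ 𝒵)))
        (pr q (secUnion S 𝒳)) (pr q (secUnion S 𝒵)) (pr q (secUnion S (𝒳 ∩ 𝒵))) hP0 hP1 hQ0 hQ1
        hxS (pr_le_one q _) hzS (pr_le_one q _) hxT (pr_le_one q _) hzT (pr_le_one q _) hyS hyT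
      linarith [key]
    · -- one of the families is empty: both sides vanish
      rw [not_and_or, Set.not_nonempty_iff_eq_empty, Set.not_nonempty_iff_eq_empty] at hne
      rcases hne with h | h
      · rw [h, hat_empty, Set.empty_inter, tcRHS_eq, Set.empty_inter, Set.inter_empty, SahiTransportCert.pr_empty]
        simp only [ind_of_not_mem (Set.notMem_empty _), mul_zero, sum_const_zero, zero_mul, sub_zero, add_zero]
        exact le_rfl
      · rw [h, hat_empty, Set.inter_empty, tcRHS_eq, Set.inter_empty, Set.inter_empty, SahiTransportCert.pr_empty]
        simp only [ind_of_not_mem (Set.notMem_empty _), mul_zero, sum_const_zero, zero_mul, sub_zero, add_zero]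
        exact le_rfl

end Cert

/-! ### Kahn's Conjecture 5 / Sahi's `C₃` for the OR of two disjoint cylinders -/

/-- **KAHN'S CONJECTURE 5 / SAHI'S `C₃` WHEN THE FIRST SLOT IS THE OR OF TWO DISJOINT CYLINDERS** (pattern form).  For a block
`e : Fin k ↪ ι` (`k ≥ 1`) with interior parameters, an increasing event `H` determined by the block whose pattern event is `orCyl S`
(`S ⊆ Fin k` arbitrary), and ALL increasing `U, V ⊆ 2^ι`: `E₃(1_H, 1_U, 1_V) ≥ 0`. [this work] -/
theorem sahiE_three_nonneg_of_orCyl {ι : Type} [Fintype ι] (p : ι → unitInterval) (e : Fin k ↪ ι) (hk : 0 < k)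
    (hp : ∀ i, 0 < (p (e i) : ℝ) ∧ (p (e i) : ℝ) < 1) {H : Set (Set ι)} (hH : DeterminedBy H (Set.range e)) (S : Set (Fin k))
    (hpat : pat e H = orCyl S) {U V : Set (Set ι)} (hU : IsUpperSet U) (hV : IsUpperSet V) :
    0 ≤ sahiE (bernoulliWeight p) 3 ![ind H, ind U, ind V] := by
  have hq : ∀ i, 0 < (pk e p i : ℝ) ∧ (pk e p i : ℝ) < 1 := hp
  have hc : RhoCert (pk e p) (pat e H) (rho (pk e p) S) := by rw [hpat]; exact rhoCert_orCyl S hq hk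
  exact sahiE_three_nonneg_of_rhoCert p e hH hc hU hV

end SahiOrCylinders

end Summit.CriticalPhenomena.PercolationContinuityZ3.Theorems
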